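import Summits.HubbardSuperconductivity.HubbardSuperconductivity.Theorems.NoOnsiteODLRO.Negative.FreeEndpointTightness
import Literature.MathematicalPhysics.QuantumLattice.FreeFermiGasNoPairFieldLRO
import Literature.MathematicalPhysics.QuantumLattice.PairFieldMomentum

/-!
# Crux `NoOnsiteODLRO` (stmt-HubbardSuperconductivity-0933) — free endpoint `U = 0`, TOOLBOX:
# the on-site pair field in momentum space, deep/shell orthogonality, multiplicity of the Fermi level

Helper lemmas for `LiebTwinNoOnsiteODLROFreeEndpoint.lean` (the `U = 0` endpoint of the crux:
every sector ground state of the free torus has on-site pair structure factor `O(L²)`):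

* `dotProduct` bookkeeping (`Re⟨Σv, Σv⟩ ≤ |S|²` by polarised Cauchy–Schwarz; Hermitian
  idempotents: `Re⟨ψ,Qψ⟩ = 0 ⇒ Qψ = 0`, `Re⟨ψ,Qψ⟩ = Re⟨ψ,ψ⟩ ⇒ Qψ = ψ`);
* `card_filter_torusBand_eq_le`: the Fermi level `{k ∈ (ℤ/Lℤ)² : ε_L(k) = μ}` has at most `2L`
  points (fix `k₁`; `cos(2πk₂/L)` takes each value at most twice, `card_filter_cos_eq_le_two`);
* `conjTranspose_pairField_sWave_mul_self`: `P_sᴴP_s = 2 BᴴB`, `B = Σ_k b_k`, `b_k = c_{-k↓}c_{k↑}`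
  (from `P_s = -√2 Σ_k b_k`, imported from `Negative/FreeEndpointTightness.lean`, which records the
  matching FLOOR: paired Fermi seas attain `S_L = N_L`);
* `n_{k↑} b_k = 0`, `[n_{k↑}, b_{k'}] = 0` (`k' ≠ k`), `‖b_k ψ‖ ≤ ‖ψ‖`, `⟨ψ,n_{k↑}ψ⟩ = ‖c_{k↑}ψ‖²`,
  and the two consequences used downstream: `⟨ψ,n_{k↑}ψ⟩ = 0 ⇒ b_kψ = 0` (above the Fermi level),
  `n_{k↑}ψ = ψ ⇒ b_kψ ⊥ b_{k'}ψ` for all `k' ≠ k` (below it).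

Sources: J. Bardeen, L. N. Cooper, J. R. Schrieffer, Phys. Rev. 108 (1957) 1175, §II;
C. N. Yang, Rev. Mod. Phys. 34 (1962) 694, §3. Folklore finite-dimensional statements; no
definitions, no named facts.
-/

noncomputable section

set_option linter.dupNamespace false

namespace Summit.HubbardSuperconductivity.HubbardSuperconductivity.Theorems.NoOnsiteODLRO.FreeEndpoint

open Matrix Literature.Probability.LatticeModels Literature.MathematicalPhysics.QuantumLattice
open Finset hiding expect
open scoped ComplexOrder ComplexConjugate

/-! ### Vectors in the `dotProduct` language -/

section Vec

variable {n : Type*} [Fintype n]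

/-- `Re⟨v, v⟩ = 0 → v = 0`. [folklore] -/
theorem eq_zero_of_re_star_dotProduct_self_eq_zero {v : n → ℂ} (h : (star v ⬝ᵥ v).re = 0) :
    v = 0 := by
  have him := (Complex.nonneg_iff.1 (dotProduct_star_self_nonneg v)).2
  exact dotProduct_star_self_eq_zero.1 (Complex.ext (by simpa using h) (by simpa using him.symm))

/-- `Re⟨Σ_{k∈S} v_k, Σ_{k∈S} v_k⟩ ≤ |S|²` when every `Re⟨v_k, v_k⟩ ≤ 1`. [folklore] -/
theorem re_star_sum_dotProduct_sum_le_card_sq {ι : Type*} (S : Finset ι) (v : ι → n → ℂ)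
    (hv : ∀ k ∈ S, (star (v k) ⬝ᵥ v k).re ≤ 1) :
    (star (∑ k ∈ S, v k) ⬝ᵥ ∑ k ∈ S, v k).re ≤ (S.card : ℝ) ^ 2 := by
  -- polarised Cauchy–Schwarz `2 Re⟨a, b⟩ ≤ Re⟨a,a⟩ + Re⟨b,b⟩` from `0 ≤ ⟨a - b, a - b⟩`
  have hcs : ∀ a b : n → ℂ, 2 * (star a ⬝ᵥ b).re ≤ (star a ⬝ᵥ a).re + (star b ⬝ᵥ b).re := by
    intro a b
    have h := (Complex.nonneg_iff.1 (dotProduct_star_self_nonneg (a - b))).1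
    rw [star_sub, sub_dotProduct, dotProduct_sub, dotProduct_sub, Complex.sub_re, Complex.sub_re,
      Complex.sub_re, star_dotProduct b a, Complex.star_def, Complex.conj_re] at h
    linarith
  rw [star_sum, sum_dotProduct, Complex.re_sum]
  simp_rw [dotProduct_sum, Complex.re_sum]
  calc ∑ k ∈ S, ∑ k' ∈ S, (star (v k) ⬝ᵥ v k').re ≤ ∑ _k ∈ S, ∑ _k' ∈ S, (1 : ℝ) := by
        refine Finset.sum_le_sum fun k hk => Finset.sum_le_sum fun k' hk' => ?_
        have := hcs (v k) (v k')
        linarith [hv k hk, hv k' hk']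
    _ = (S.card : ℝ) ^ 2 := by simp [sq]

/-- For a Hermitian idempotent `Q`: `⟨Qψ, Qψ⟩ = ⟨ψ, Qψ⟩`. [folklore] -/
theorem star_proj_mulVec_dotProduct_self {Q : Matrix n n ℂ} (hQ : Q.IsHermitian) (hQQ : Q * Q = Q)
    (ψ : n → ℂ) : star (Q *ᵥ ψ) ⬝ᵥ (Q *ᵥ ψ) = star ψ ⬝ᵥ (Q *ᵥ ψ) := by
  rw [star_mulVec_dotProduct_mulVec, hQ.eq, hQQ]

/-- For a Hermitian idempotent `Q`: `Re⟨ψ, Qψ⟩ = 0 → Qψ = 0`. [folklore] -/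
theorem proj_mulVec_eq_zero_of_re_eq_zero {Q : Matrix n n ℂ} (hQ : Q.IsHermitian)
    (hQQ : Q * Q = Q) {ψ : n → ℂ} (h : (star ψ ⬝ᵥ (Q *ᵥ ψ)).re = 0) : Q *ᵥ ψ = 0 :=
  eq_zero_of_re_star_dotProduct_self_eq_zero (by rw [star_proj_mulVec_dotProduct_self hQ hQQ, h])

/-- For a Hermitian idempotent `Q`: `Re⟨ψ, Qψ⟩ = Re⟨ψ, ψ⟩ → Qψ = ψ`. [folklore] -/
theorem proj_mulVec_eq_self_of_re_eq [DecidableEq n] {Q : Matrix n n ℂ} (hQ : Q.IsHermitian)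
    (hQQ : Q * Q = Q) {ψ : n → ℂ} (h : (star ψ ⬝ᵥ (Q *ᵥ ψ)).re = (star ψ ⬝ᵥ ψ).re) :
    Q *ᵥ ψ = ψ := by
  obtain ⟨h1, h2⟩ := Literature.Computability.AlgebraicComplexity.one_sub_proj hQ hQQ
  have h0 := proj_mulVec_eq_zero_of_re_eq_zero h1 h2 (ψ := ψ)
    (by rw [sub_mulVec, one_mulVec, dotProduct_sub, Complex.sub_re, h, sub_self])
  rw [sub_mulVec, one_mulVec, sub_eq_zero] at h0
  exact h0.symm

end Vec

/-! ### The Fermi level has multiplicity at most `2L` on the square torus -/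

section Shell

variable {L : ℕ} [NeZero L]

/-- At most two residues `j mod L` share a value of `cos(2πj/L)` (`cos` is injective on `[0,π]`
and on `[π,2π]`). [folklore] -/
theorem card_filter_cos_eq_le_two (c : ℝ) :
    (univ.filter fun j : ZMod L => Real.cos (2 * Real.pi * (j.val : ℝ) / L) = c).card ≤ 2 := by
  set T := univ.filter fun j : ZMod L => Real.cos (2 * Real.pi * (j.val : ℝ) / L) = c with hT
  have hL0 : (0 : ℝ) < L := Nat.cast_pos.2 (Nat.pos_of_ne_zero (NeZero.ne L))
  have hθ0 : ∀ j : ZMod L, 0 ≤ 2 * Real.pi * (j.val : ℝ) / L := fun j => by positivity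
  have hθ2 : ∀ j : ZMod L, 2 * Real.pi * (j.val : ℝ) / L < 2 * Real.pi := fun j => by
    rw [div_lt_iff₀ hL0]
    have : (j.val : ℝ) < L := by exact_mod_cast ZMod.val_lt j
    nlinarith [Real.pi_pos]
  have hcancel : ∀ a b : ZMod L,
      2 * Real.pi * (a.val : ℝ) / L = 2 * Real.pi * (b.val : ℝ) / L → a = b := by
    intro a b h
    apply ZMod.val_injective L
    have h' : (a.val : ℝ) = b.val := by
      have hπ : (2 * Real.pi / L : ℝ) ≠ 0 := by positivity
      have : 2 * Real.pi / L * (a.val : ℝ) = 2 * Real.pi / L * (b.val : ℝ) := by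
        rw [div_mul_eq_mul_div, div_mul_eq_mul_div]; exact h
      exact mul_left_cancel₀ hπ this
    exact_mod_cast h'
  have h1 : (T.filter fun j : ZMod L => 2 * j.val ≤ L).card ≤ 1 := by
    rw [Finset.card_le_one]
    intro a ha b hb
    simp only [hT, mem_filter, mem_univ, true_and] at ha hb
    have hle : ∀ j : ZMod L, 2 * j.val ≤ L → 2 * Real.pi * (j.val : ℝ) / L ≤ Real.pi := by
      intro j hj
      rw [div_le_iff₀ hL0]
      have : (2 * j.val : ℝ) ≤ L := by exact_mod_cast hj
      nlinarith [Real.pi_pos]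
    exact hcancel a b (Real.injOn_cos ⟨hθ0 a, hle a ha.2⟩ ⟨hθ0 b, hle b hb.2⟩
      (ha.1.trans hb.1.symm))
  have h2 : (T.filter fun j : ZMod L => ¬ 2 * j.val ≤ L).card ≤ 1 := by
    rw [Finset.card_le_one]
    intro a ha b hb
    simp only [hT, mem_filter, mem_univ, true_and, not_le] at ha hb
    have hge : ∀ j : ZMod L, L < 2 * j.val → Real.pi ≤ 2 * Real.pi * (j.val : ℝ) / L := by
      intro j hj
      rw [le_div_iff₀ hL0]
      have : (L : ℝ) ≤ 2 * j.val := by exact_mod_cast hj.le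
      nlinarith [Real.pi_pos]
    have hmem : ∀ j : ZMod L, L < 2 * j.val →
        2 * Real.pi - 2 * Real.pi * (j.val : ℝ) / L ∈ Set.Icc 0 Real.pi := fun j hj =>
      ⟨by linarith [hθ2 j], by linarith [hge j hj]⟩
    have hcos := ha.1.trans hb.1.symm
    rw [← Real.cos_two_pi_sub, ← Real.cos_two_pi_sub (2 * Real.pi * (b.val : ℝ) / L)] at hcos
    have := Real.injOn_cos (hmem a ha.2) (hmem b hb.2) hcos
    exact hcancel a b (by linarith)
  have := Finset.card_filter_add_card_filter_not (s := T) (fun j : ZMod L => 2 * j.val ≤ L)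
  omega

/-- **The Fermi level of the square torus has multiplicity at most `2L`**: for every real `μ`,
`#{k ∈ (ℤ/Lℤ)² : ε_L(k) = μ} ≤ 2L` (`ε_L(k) = -2(cos p₁ + cos p₂)`; fix `k₁`, then `cos p₂` is
prescribed). [folklore] -/
theorem card_filter_torusBand_eq_le (μ : ℝ) :
    (univ.filter fun k : TorusSite 2 L => torusBand L k = μ).card ≤ 2 * L := by
  set Sh := univ.filter fun k : TorusSite 2 L => torusBand L k = μ with hSh
  have hband : ∀ k : TorusSite 2 L, torusBand L k =
      -2 * (Real.cos (2 * Real.pi * ((k 0).val : ℝ) / L) +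
        Real.cos (2 * Real.pi * ((k 1).val : ℝ) / L)) := by
    intro k
    simp only [torusBand, latticeMomentum, Fin.sum_univ_two]
  have key : ∀ a ∈ Sh.image (fun k : TorusSite 2 L => k 0),
      (Sh.filter fun k : TorusSite 2 L => k 0 = a).card ≤ 2 := by
    intro a _
    refine le_trans (Finset.card_le_card_of_injOn (fun k : TorusSite 2 L => k 1) ?_ ?_)
      (card_filter_cos_eq_le_two (L := L) (-μ / 2 - Real.cos (2 * Real.pi * (a.val : ℝ) / L)))
    · intro k hk
      have hk' := hk
      simp only [hSh, coe_filter, mem_filter, mem_univ, true_and, Set.mem_setOf_eq] at hk'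
      simp only [coe_filter, mem_univ, true_and, Set.mem_setOf_eq]
      have h := hband k
      rw [hk'.1, hk'.2] at h
      linarith
    · intro k hk k' hk' h
      simp only [hSh, coe_filter, mem_filter, mem_univ, true_and, Set.mem_setOf_eq] at hk hk'
      funext i
      fin_cases i
      · exact hk.2.trans hk'.2.symm
      · exact h
  calc Sh.card ≤ 2 * (Sh.image fun k : TorusSite 2 L => k 0).card := card_le_mul_card_image Sh 2 key
    _ ≤ 2 * L := by
        gcongr
        calc (Sh.image fun k : TorusSite 2 L => k 0).card ≤ (univ : Finset (ZMod L)).card :=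
              card_le_univ _
          _ = L := by rw [Finset.card_univ, ZMod.card]

/-- REGISTERED HELPER STUB `stub_fermiLevelMultiplicity` of crux stmt-HubbardSuperconductivity-0933
(verbatim signature): the Fermi level of the square torus has multiplicity at most `2L`
(`= card_filter_torusBand_eq_le`). [folklore] -/
theorem stub_fermiLevelMultiplicity :
    ∀ (L : ℕ) [NeZero L] (μ : ℝ),
      (Finset.univ.filter fun k : TorusSite 2 L => torusBand L k = μ).card ≤ 2 * L :=
  fun _ _ μ => card_filter_torusBand_eq_le μ

end Shell

/-! ### The on-site pair field in momentum space -/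

section Momentum

variable {L : ℕ} [NeZero L]

/-- `P_sᴴ P_s = 2 · (Σ_k b_k)ᴴ (Σ_k b_k)` (from `P_s = -√2 Σ_k b_k`,
`Negative.pairField_sWave_eq_neg_smul_sum_pairMode` of `FreeEndpointTightness`). [folklore] -/
theorem conjTranspose_pairField_sWave_mul_self :
    (pairField sWave L)ᴴ * pairField sWave L =
      ((2 : ℝ) : ℂ) • ((∑ k : TorusSite 2 L, pairMode k)ᴴ * ∑ k : TorusSite 2 L, pairMode k) := by
  rw [Negative.pairField_sWave_eq_neg_smul_sum_pairMode, conjTranspose_neg, conjTranspose_smul,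
    neg_mul_neg,
    smul_mul_smul_comm, Complex.star_def, Complex.conj_ofReal, ← Complex.ofReal_mul,
    Real.mul_self_sqrt zero_le_two]

/-- `n_{k↑} b_k = 0` (`b_k = c_{-k↓} c_{k↑}`, Pauli). [folklore] -/
theorem momentumNumber_up_mul_pairMode_self (k : TorusSite 2 L) :
    momentumNumber k 0 * pairMode k = 0 := by
  have h : ¬ (k = -k ∧ (0 : Fin 2) = 1) := fun h => absurd h.2 (by decide)
  rw [pairMode, ← Matrix.mul_assoc, momentumNumber_mul_momentumAnnihilation_of_ne h,
    Matrix.mul_assoc, momentumNumber_mul_momentumAnnihilation_self, Matrix.mul_zero]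

/-- `n_{k↑}` commutes with `b_{k'}` for `k' ≠ k`. [folklore] -/
theorem momentumNumber_up_mul_pairMode_of_ne {k k' : TorusSite 2 L} (hkk' : k ≠ k') :
    momentumNumber k 0 * pairMode k' = pairMode k' * momentumNumber k 0 := by
  have h1 : ¬ (k = -k' ∧ (0 : Fin 2) = 1) := fun h => absurd h.2 (by decide)
  have h2 : ¬ (k = k' ∧ (0 : Fin 2) = 0) := fun h => hkk' h.1
  rw [pairMode, ← Matrix.mul_assoc, momentumNumber_mul_momentumAnnihilation_of_ne h1,
    Matrix.mul_assoc, momentumNumber_mul_momentumAnnihilation_of_ne h2, ← Matrix.mul_assoc]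

/-- `b_k† b_k = n_{k↑} n_{-k↓}` is a Hermitian idempotent. [folklore] -/
theorem pairNumber_isHermitian_and_idem (k : TorusSite 2 L) :
    (momentumNumber k 0 * momentumNumber (-k) 1).IsHermitian ∧
      (momentumNumber k 0 * momentumNumber (-k) 1) * (momentumNumber k 0 * momentumNumber (-k) 1) =
        momentumNumber k 0 * momentumNumber (-k) 1 := by
  have hc := (momentumNumber_commute k (-k) 0 1).eq
  refine ⟨?_, ?_⟩
  · change (momentumNumber k 0 * momentumNumber (-k) 1)ᴴ = _
    rw [conjTranspose_mul, momentumNumber_conjTranspose, momentumNumber_conjTranspose, ← hc]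
  · rw [Matrix.mul_assoc, ← Matrix.mul_assoc (momentumNumber (-k) 1) (momentumNumber k 0),
      ← hc, Matrix.mul_assoc, momentumNumber_mul_self, ← Matrix.mul_assoc, momentumNumber_mul_self]

/-- `Re⟨b_k ψ, b_k ψ⟩ ≤ Re⟨ψ, ψ⟩` (`‖b_k‖ ≤ 1`). [folklore] -/
theorem re_star_pairMode_mulVec_dotProduct_self_le (k : TorusSite 2 L)
    (ψ : Fock (Orb (FermionTorus 2 L))) :
    (star (pairMode k *ᵥ ψ) ⬝ᵥ (pairMode k *ᵥ ψ)).re ≤ (star ψ ⬝ᵥ ψ).re := by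
  obtain ⟨hA, hAA⟩ := pairNumber_isHermitian_and_idem k
  rw [star_mulVec_dotProduct_mulVec, conjTranspose_pairMode_mul_self]
  exact Literature.Computability.AlgebraicComplexity.re_dotProduct_mulVec_le hA hAA ψ

/-- The `↑`-occupation is the squared norm of `c_{k↑} ψ`: `⟨ψ, n_{k↑} ψ⟩ = ⟨c_{k↑}ψ, c_{k↑}ψ⟩`.
[folklore] -/
theorem star_dotProduct_momentumNumber_mulVec (k : TorusSite 2 L) (σ : Fin 2)
    (ψ : Fock (Orb (FermionTorus 2 L))) :
    star ψ ⬝ᵥ (momentumNumber k σ *ᵥ ψ) =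
      star (momentumAnnihilation k σ *ᵥ ψ) ⬝ᵥ (momentumAnnihilation k σ *ᵥ ψ) := by
  rw [star_mulVec_dotProduct_mulVec, momentumAnnihilation_conjTranspose, momentumNumber]

/-- Above the Fermi level: `⟨ψ, n_{k↑}ψ⟩ = 0 → b_k ψ = 0`. [folklore] -/
theorem pairMode_mulVec_eq_zero_of_occupation_eq_zero (k : TorusSite 2 L)
    {ψ : Fock (Orb (FermionTorus 2 L))} (h : (star ψ ⬝ᵥ (momentumNumber k 0 *ᵥ ψ)).re = 0) :
    pairMode k *ᵥ ψ = 0 := by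
  rw [star_dotProduct_momentumNumber_mulVec] at h
  have h0 := eq_zero_of_re_star_dotProduct_self_eq_zero h
  rw [pairMode, ← mulVec_mulVec, h0, mulVec_zero]

/-- Below the Fermi level: `⟨ψ, n_{k↑}ψ⟩ = ⟨ψ, ψ⟩ → n_{k↑} ψ = ψ`. [folklore] -/
theorem momentumNumber_mulVec_eq_self_of_occupation_eq (k : TorusSite 2 L)
    {ψ : Fock (Orb (FermionTorus 2 L))}
    (h : (star ψ ⬝ᵥ (momentumNumber k 0 *ᵥ ψ)).re = (star ψ ⬝ᵥ ψ).re) :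
    momentumNumber k 0 *ᵥ ψ = ψ :=
  proj_mulVec_eq_self_of_re_eq (momentumNumber_conjTranspose k 0) (momentumNumber_mul_self k 0) h

/-- **Deep pair removals are orthogonal to all others**: if `n_{k↑} ψ = ψ` then
`⟨b_k ψ, b_{k'} ψ⟩ = 0` for every `k' ≠ k`. [folklore] -/
theorem star_pairMode_mulVec_dotProduct_of_ne {k k' : TorusSite 2 L} (hkk' : k ≠ k')
    {ψ : Fock (Orb (FermionTorus 2 L))} (hfix : momentumNumber k 0 *ᵥ ψ = ψ) :
    star (pairMode k *ᵥ ψ) ⬝ᵥ (pairMode k' *ᵥ ψ) = 0 := by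
  have hH : (momentumNumber k 0)ᴴ = momentumNumber k 0 := momentumNumber_conjTranspose k 0
  have hw : pairMode k' *ᵥ ψ = momentumNumber k 0 *ᵥ (pairMode k' *ᵥ ψ) := by
    conv_lhs => rw [← hfix]
    rw [mulVec_mulVec, mulVec_mulVec, momentumNumber_up_mul_pairMode_of_ne hkk']
  calc star (pairMode k *ᵥ ψ) ⬝ᵥ (pairMode k' *ᵥ ψ)
        = star (pairMode k *ᵥ ψ) ⬝ᵥ (momentumNumber k 0 *ᵥ (pairMode k' *ᵥ ψ)) := by rw [← hw]
    _ = star (momentumNumber k 0 *ᵥ (pairMode k *ᵥ ψ)) ⬝ᵥ (pairMode k' *ᵥ ψ) := by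
          rw [star_mulVec (momentumNumber k 0) (pairMode k *ᵥ ψ), ← dotProduct_mulVec, hH]
    _ = 0 := by rw [mulVec_mulVec, momentumNumber_up_mul_pairMode_self, zero_mulVec, star_zero,
          zero_dotProduct]

end Momentum

end Summit.HubbardSuperconductivity.HubbardSuperconductivity.Theorems.NoOnsiteODLRO.FreeEndpoint

end
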